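import Summits.BirchSwinnertonDyer.BirchSwinnertonDyer.Theorems.BiquadraticEisensteinDescentHeegnerTwistCouplingInSupplyKrizLiCornerQT27
import Summits.BirchSwinnertonDyer.BirchSwinnertonDyer.Theorems.PrintCFramBottomClassIndexLawFiveLeKrizLi4Blocks11a
import Summits.BirchSwinnertonDyer.BirchSwinnertonDyer.Theorems.PrintCFramBottomClassIndexLawFiveLeKrizLi4Blocks11b
import Summits.BirchSwinnertonDyer.BirchSwinnertonDyer.Theorems.PrintCFramBottomClassIndexLawFiveLeKrizLi4BlocksB11
import Summits.BirchSwinnertonDyer.BirchSwinnertonDyer.Theorems.PrintCFramBottomClassIndexLawFiveLeKrizLi4HeegnerHypothesis11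
import Summits.BirchSwinnertonDyer.BirchSwinnertonDyer.Theorems.PrintCFramBottomClassIndexLawFiveLeKrizLiBinders
import Summits.BirchSwinnertonDyer.Rank1Residual.X12.CMIsogenyInvariance
import Summits.BirchSwinnertonDyer.Rank1Residual.X12.CMRamifiedAdditive
import Literature.NumberTheory.EllipticCurves.DeuringHeckeContinuationHasCM
import Literature.NumberTheory.EllipticCurves.KrizLi2019.ThreeClassNumbers
import HarnessLib

set_option linter.dupNamespace false -- `Summit.BirchSwinnertonDyer.BirchSwinnertonDyer.Theorems.…` (summit = sub, D-0017)
set_option autoImplicit false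

/-!
# Crux `HeegnerTwistCouplingInSupply` (stmt-BirchSwinnertonDyer-21381) — the GROSS-CURVE Kriz–Li corners:
# the crux's conclusion at `(W, p)` for `W ∼ A(11)^{(e)}` with an inert crux prime `p ∣ e`, from cell `bsd-print-cfram`'s
# Kriz–Li window classes (`ℚ(√−11)`; part I — odd twisting discriminants)

Route `BiquadraticEisensteinDescent` (cell `pub/bsd-wall`, width seat `bsd-wall-cm-bed-w4` g28; `--supports` 21381, helper). The crux's
habitat at the CM field `ℚ(√−q)`, `q ∈ {11, 19, 43, 67, 163}`, consists of the twists `W ∼ A(q)^{(e)}` of Gross's curve `A(q)` (rank one,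
`w = −1`; `w(A(q)^{(e)}) = −1` iff `e > 0`) that are bad at a prime `p ≥ 5` INERT in `ℚ(√−q)` — i.e. `p ∣ e` with `(p/q) = −1`. No corner of
crux 21381 existed on these five classes (CORNER-INDEX-w1g25 §1). Cell `bsd-print-cfram` (crux `PrintCFram.BottomClassIndexLawFiveLe`) has put
its «Kriz–Li window classes» `W ∼ A(q)^{(e)}` ON THE KRIZ–LI LOCUS at the Eisenstein prime `p_KL = q` BY NAME: per class and census Heegner
field `K'' = ℚ(√d)`, the character ∧ `ε_K` ∧ Bernoulli block `KrizLiBindersTwisted.exists_krizLiCharacterBlock_<label>` (kernel Bernoulli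
certificates `KrizLi4Cert*`) and the Heegner hypothesis `satisfiesHeegnerHypothesis_<label>`. THIS FILE composes them with a `p`-GENERIC form of
the modularity-free Kriz–Li door of `…KrizLiCornerQT27` §1:

* §1 ★ `twist_L_one_ne_zero_of_thm120_cm` — for ANY odd prime `q ≥ 5`, a globally minimal CM curve `W` with `q` CM-ramified (so `W` is
  additive at `q`, `q ∣ N_W`: `X12.not_good_of_cmRamified`) and `r_an(W) ≠ 0`, an imaginary quadratic `K` Heegner for `N_W`, and Kriz–Li's
  data at `q` (`ψ`, `ω`, trace form, (1), (3), `ε_K`, (4)): **`L(W^{(d_K)}, 1) ≠ 0 ∧ r_an(W^{(d_K)}) = 0`** MODULO `hKL` (Kriz–Li Thm. 1.20),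
  `hGZ` (Gross–Zagier), `hHP` (Heegner point) — both continuations from Deuring–Hecke (`DeuringHecke.hasEntireLFunction_of_hasCM`,
  `hasCM_quadraticTwist`), `L(W, 1) = 0` from `r_an ≠ 0`, product rule `KrizLiCornerQT27.twist_entireLFunction_one_ne_zero_of_lDerivEK_ne_zero`.
* §2 `hasCM_cmRamified_of_twist` — class membership `W ∼ W₁`, `C • W₁ = A^{(e)}` gives `W.HasCM ∧ CMRamified W q` (isogeny invariance,
  `X12.hasCM_of_isIsogenous` / `X12.cmRamified_iff_of_isIsogenous`).
* §3 ★ the ROWS at `q = 11`, odd `e` (crux prime `p` = the inert prime factor of `e`; `K′ = K''` of the census, produced as a type by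
  `SylvesterCorner.exists_field_of_odd`; `p ∤ h(K′)` by SIZE, `h(d)` a kernel value): `20449a1 = A(11)^{(13)}` (`p = 13`, `K′ = ℚ(√−43)`),
  `34969a1 = A(11)^{(17)}` (`17`, `√−19`), `101761a1 = A(11)^{(29)}` (`29`, `√−7`), `450241d1 = A(11)^{(61)}` (`61`, `√−19`),
  `53361y1 = A(11)^{(21)}` (`p = 7`, `√−83`, `h = 3`), `393129bw1 = A(11)^{(57)}` (`p = 19`, `√−107`, `h = 3`), `203401d1 = A(11)^{(41)}`
  (`41`, `√−39`, `h = 4`): **`∃ K′` imaginary quadratic, `4 < |d_{K′}|`, Heegner for `N_W`, `L(W^{(d_{K′})}, 1) ≠ 0`, `p ∤ h(K′)`** — the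
  CONCLUSION of crux 21381 at `(W, p)` for every globally minimal member `W` with `r_an(W) ≠ 0`, modulo `hKL`, `hGZ`, `hHP` ONLY;
  and ★ `cruxBody_20449a1` — the crux's BODY verbatim at `(W, 13)` on that class. Part II (`…KrizLiGrossCornerII`): the even-type rows at
  `q = 11` and the rows at `q = 19, 43, 67`.

HONEST FRAMING: corner layer on finitely many isogeny classes (cfram's window); the crux (all CM `W`, all `p`), C⁺, its registered stubs and
BSD are NOT proved. THEOREMS ONLY. Supports stmt-BirchSwinnertonDyer-21381.
[cite: KrizLi2019, Thm. 1.20 (pp. 7–8), Rem. 1.21] [cite: GrossZagier1986, Thm. I.(6.3), V.§1–2] [cite: GrossLMS1991, §1]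
[cite: Cox2013, §2.A Thm. 2.13; §7.B Thm. 7.7(ii)]
-/

noncomputable section

open scoped Classical NumberTheorySymbols

namespace Summit.BirchSwinnertonDyer.BirchSwinnertonDyer.Theorems.KrizLiGrossCorner

open _root_.WeierstrassCurve NumberField
open Literature.NumberTheory.EllipticCurves Literature.NumberTheory.EllipticCurves.KrizLi2019
  Literature.NumberTheory.EllipticCurves.ModularForms Literature.NumberTheory.EllipticCurves.Rank1Residual
  Literature.NumberTheory.QuadraticFields Literature.NumberTheory.QuadraticFields.Quadratic
  Summit.BirchSwinnertonDyer.Rank1Residual Summit.BirchSwinnertonDyer.Rank1Residual.X12.O11.RouteU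
  Summit.BirchSwinnertonDyer.BirchSwinnertonDyer.Theorems.PrintCFram
  Summit.BirchSwinnertonDyer.BirchSwinnertonDyer.Theorems.PrintCFram.KrizLiBindersTwisted

/-! ## §1 The Kriz–Li door at a CM-ramified Eisenstein prime `q ≥ 5`, modularity-free -/

section Door

variable {p : ℕ} [hp : Fact p.Prime]

/-- ★ **The Kriz–Li door at a CM-ramified prime `p ≥ 5`, without the modularity leaf.** For a globally minimal CM curve `W/ℚ` with
`p` ramified in its CM field (`CMRamified W p`, so `W` is additive at `p` and `p ∣ N_W`) and `r_an(W) ≠ 0`, an imaginary quadratic `K`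
Heegner for `N_W`, and Kriz–Li's data at `p` — `(f, ψ, ω)`, the trace form `hss`, (1), (3), a Kronecker character `ε_K`, the Bernoulli
unit condition — MODULO `hKL` (Kriz–Li Thm. 1.20), `hGZ` (Gross–Zagier), `hHP` (a Heegner point exists): **`L(W^{(d_K)}, 1) ≠ 0` and
`r_an(W^{(d_K)}) = 0`.** Chain: `hHP` gives the Heegner datum; `PrintCFram.KrizLiLValueFree.lDerivEK_ne_zero_of_thm120` gives
`L′(W/K, 1) ≠ 0` (Kriz–Li's (2) is vacuous for CM); continuations of `W` and `W^{(d_K)}` from Deuring–Hecke (`hasEntireLFunction_of_hasCM`,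
`hasCM_quadraticTwist`); `L(W, 1) = 0` from `r_an(W) ≠ 0`; product rule. [cite: KrizLi2019, Thm. 1.20 (pp. 7–8), Rem. 1.21]
[cite: GrossZagier1986, Thm. I.(6.3), V.§1–2] -/
theorem twist_L_one_ne_zero_of_thm120_cm (hp5 : 5 ≤ p) (hKL : thm120_padicLogHeegner_unit_of_bernoulli)
    (W : WeierstrassCurve ℚ) [W.IsElliptic] [W.IsGloballyMinimal] [NeZero (W.conductorNorm ℤ)]
    (hCM : W.HasCM) (hram : CMRamified W p) (hr : W.analyticRank ≠ 0)
    (K : Type) [Field K] [NumberField K] (hK : IsImaginaryQuadratic K)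
    (hHN : SatisfiesHeegnerHypothesis (W.conductorNorm ℤ) K)
    (hGZ : gross_zagier (W.conductorNorm ℤ) W K) (hHP : exists_isHeegnerPoint W K)
    (f : ℕ) [NeZero f] (ψ : DirichletCharacter ℚ_[p] f) (ω : DirichletCharacter ℚ_[p] p)
    (hψ : ψ.IsPrimitive) (hω : IsTeichmullerCharacter ω)
    (hss : ∀ ℓ : ℕ, ℓ.Prime → ¬ (ℓ ∣ p * W.conductorNorm ℤ) →
      ‖((W.LFunction ℓ : ℤ) : ℚ_[p]) - (ψ (ℓ : ZMod f) + ψ⁻¹ (ℓ : ZMod f) * ω (ℓ : ZMod p))‖ < 1)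
    (h1a : ψ (p : ZMod f) ≠ 1) (h1b : primVal (invMulOmega ψ ω) p ≠ 1)
    (h3 : ∀ ℓ : ℕ, (hℓ : ℓ.Prime) → ℓ ≠ p →
      (haveI := Fact.mk hℓ; ¬ W.HasGoodReductionAtPrime ℓ ∧ ¬ W.HasMultiplicativeReductionAtPrime ℓ) →
      ψ (ℓ : ZMod f) ≠ 1 ∧ primVal (invMulOmega ψ ω) ℓ ≠ 1)
    (εK : DirichletCharacter ℚ_[p] (NumberField.discr K).natAbs) (hεK : IsKroneckerCharacterOf K εK)
    (hB : ¬ (‖bernoulliOnePrim (bernoulliCharOne ψ εK) * bernoulliOnePrim (bernoulliCharTwo ψ εK ω)‖ ≤ (p : ℝ)⁻¹)) :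
    (W.quadraticTwist (NumberField.discr K : ℚ)).entireLFunction 1 ≠ 0 ∧
      (W.quadraticTwist (NumberField.discr K : ℚ)).analyticRank = 0 := by
  have hp2 : p ≠ 2 := by omega
  have hd0 : (NumberField.discr K : ℚ) ≠ 0 := by exact_mod_cast NumberField.discr_ne_zero K
  haveI := W.isElliptic_quadraticTwist hd0
  -- the Heegner datum from the named fact
  obtain ⟨P, Dt, H, ι, hP⟩ := hHP hK hHN
  -- Kriz–Li (2) is vacuous for CM; `p ∣ N(W)` since `W` is bad at the CM-ramified `p`
  have h2 := not_hasSplitMultiplicativeReductionAtPrime_of_hasCM W hCM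
  have hpN : p ∣ W.conductorNorm ℤ :=
    (W.dvd_conductorNorm_iff_not_hasGoodReductionAtPrime p).mpr (X12.not_good_of_cmRamified W p hCM hp2 hram)
  -- `L′(W/K, 1) ≠ 0`
  have hL' : LDerivEK W K ≠ 0 :=
    KrizLiLValueFree.lDerivEK_ne_zero_of_thm120 hKL hp2 W h2 (W.conductorNorm ℤ) K hGZ Dt H ι P rfl hK hHN hpN
      hP f ψ ω hψ hω hss h1a h1b h3 εK hεK hB
  -- continuations from Deuring–Hecke (CM for `W` and its twist)
  have hW : W.HasEntireLFunction := DeuringHecke.hasEntireLFunction_of_hasCM W hCM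
  have hWt : (W.quadraticTwist (NumberField.discr K : ℚ)).HasEntireLFunction :=
    DeuringHecke.hasEntireLFunction_of_hasCM _ (hasCM_quadraticTwist W hd0 hCM)
  have h0 : W.entireLFunction 1 = 0 := by
    by_contra h
    exact hr ((analyticRank_eq_zero_iff_holds (W := W) hW).2 h)
  have hL := KrizLiCornerQT27.twist_entireLFunction_one_ne_zero_of_lDerivEK_ne_zero W K hW hWt h0 hL'
  exact ⟨hL, (analyticRank_eq_zero_iff_holds (W := W.quadraticTwist (NumberField.discr K : ℚ)) hWt).2 hL⟩

end Door

/-! ## §2 Class membership gives CM and CM-ramification -/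

/-- **`W ∼ W₁`, `C • W₁ = A^{(e)}` with `A` CM and `q` CM-ramified ⟹ `W` is CM, `q` is CM-ramified for `W`, and `W₁` is CM** (the
`j`-invariant is unchanged by `C` and by the twist; CM and the CM field are `ℚ`-isogeny invariants, `X12.hasCM_of_isIsogenous`,
`X12.cmRamified_iff_of_isIsogenous`). [cite: SilvermanAEC2009, III.1.4(b), X.5 Prop. 5.4, App. C §11] -/
theorem hasCM_cmRamified_of_twist {q : ℕ} (A : WeierstrassCurve ℚ) [A.IsElliptic] (hA : A.HasCM) (hAq : CMRamified A q)
    {e : ℤ} (he : e ≠ 0) (W W₁ : WeierstrassCurve ℚ) [W.IsElliptic] [W₁.IsElliptic] (hiso : IsIsogenous W W₁)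
    (hW₁ : ∃ C : VariableChange ℚ, C • W₁ = A.quadraticTwist ((e : ℤ) : ℚ)) :
    W.HasCM ∧ CMRamified W q ∧ W₁.HasCM := by
  have hd : ((e : ℤ) : ℚ) ≠ 0 := by exact_mod_cast he
  haveI := A.isElliptic_quadraticTwist hd
  obtain ⟨C, hC⟩ := hW₁
  have key : ∀ (V : WeierstrassCurve ℚ) [V.IsElliptic], C • W₁ = V → W₁.j = V.j :=
    fun V _ h ↦ by subst h; exact (W₁.variableChange_j C).symm
  have hj : W₁.j = A.j := (key _ hC).trans (A.j_quadraticTwist hd)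
  have hCM₁ : W₁.HasCM := (hasCM_iff_of_j_eq hj).mpr hA
  have hCM : W.HasCM := X12.hasCM_of_isIsogenous hiso.symm_of_charZero hCM₁
  have hram₁ : CMRamified W₁ q := by unfold CMRamified at hAq ⊢; rwa [hj]
  exact ⟨hCM, (X12.cmRamified_iff_of_isIsogenous hiso hCM q).mpr hram₁, hCM₁⟩

/-! ## §3 ★ The rows at `q = 11` with odd twisting discriminant -/

section Rows11


/-- **Row assembly at `q = 11`.** For a class `W ∼ W₁ ≅ A(11)^{(e)}` (`e ≠ 0`) whose Kriz–Li block and Heegner hypothesis over the census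
field of discriminant `d` are theorems for EVERY quadratic `K` with `d_K = d` (cfram's `exists_krizLiCharacterBlock_<label>` /
`satisfiesHeegnerHypothesis_<label>`, abstracted as `hblock` / `hheeg`), a kernel class number `h(d) = h` with `d < −4` odd squarefree
(`d ≡ 1 (mod 4)`), and a crux prime `p` with `h < p`: the CONCLUSION of crux 21381 at `(W, p)` modulo `hKL`, `hGZ`, `hHP`.
[cite: KrizLi2019, Thm. 1.20 (pp. 7–8)] [cite: Cox2013, §2.A Thm. 2.13; §7.B Thm. 7.7(ii)] -/
theorem cruxConclusion_of_block11 (hKL : thm120_padicLogHeegner_unit_of_bernoulli)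
    (hGZ : ∀ (N : ℕ) [NeZero N] (W : WeierstrassCurve ℚ) (K : Type) [Field K] [NumberField K], gross_zagier N W K)
    (hHP : ∀ (W : WeierstrassCurve ℚ) (K : Type) [Field K] [NumberField K], exists_isHeegnerPoint W K)
    (W W₁ : WeierstrassCurve ℚ) [W.IsElliptic] [W.IsGloballyMinimal] [NeZero (W.conductorNorm ℤ)] [W₁.IsElliptic]
    (hiso : IsIsogenous W W₁) {e : ℤ} (he : e ≠ 0) (hW₁ : ∃ C : VariableChange ℚ, C • W₁ = cm11.quadraticTwist ((e : ℤ) : ℚ))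
    (hr : W.analyticRank ≠ 0) {d : ℤ} {h p : ℕ} (hd0 : d < 0) (hd4 : d % 4 = 1) (hsf : Squarefree d.natAbs) (hd5 : 4 < d.natAbs)
    (hclass : BinQF.classNumber d = h) (hhp : h < p)
    (hblock : ∀ (K : Type) [Field K] [NumberField K], Module.finrank ℚ K = 2 → NumberField.discr K = d →
      ∀ [NeZero (NumberField.discr K).natAbs],
      ∃ (f : ℕ) (_ : NeZero f) (ψ : DirichletCharacter ℚ_[11] f) (ω : DirichletCharacter ℚ_[11] 11)
        (εK : DirichletCharacter ℚ_[11] (NumberField.discr K).natAbs),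
        ψ.IsPrimitive ∧ IsTeichmullerCharacter ω ∧
        (∀ ℓ : ℕ, ℓ.Prime → ¬ (ℓ ∣ 11 * W.conductorNorm ℤ) →
          ‖((W.LFunction ℓ : ℤ) : ℚ_[11]) - (ψ (ℓ : ZMod f) + ψ⁻¹ (ℓ : ZMod f) * ω (ℓ : ZMod 11))‖ < 1) ∧
        (ψ ((11 : ℕ) : ZMod f) ≠ 1 ∧ primVal (invMulOmega ψ ω) 11 ≠ 1) ∧
        (∀ ℓ : ℕ, (hℓ : ℓ.Prime) → ℓ ≠ 11 →
          (haveI := Fact.mk hℓ; ¬ W.HasGoodReductionAtPrime ℓ ∧ ¬ W.HasMultiplicativeReductionAtPrime ℓ) →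
          ψ (ℓ : ZMod f) ≠ 1 ∧ primVal (invMulOmega ψ ω) ℓ ≠ 1) ∧
        IsKroneckerCharacterOf K εK ∧
        ¬ (‖bernoulliOnePrim (bernoulliCharOne ψ εK) * bernoulliOnePrim (bernoulliCharTwo ψ εK ω)‖ ≤ ((11 : ℕ) : ℝ)⁻¹) ∧
        ψ.Odd)
    (hheeg : ∀ (K : Type) [Field K] [NumberField K], Module.finrank ℚ K = 2 → NumberField.discr K = d →
      SatisfiesHeegnerHypothesis (W.conductorNorm ℤ) K) :
    ∃ (K : Type) (_ : Field K) (_ : NumberField K),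
      IsImaginaryQuadratic K ∧ 4 < (NumberField.discr K).natAbs ∧
      SatisfiesHeegnerHypothesis (W.conductorNorm ℤ) K ∧
      (W.quadraticTwist (NumberField.discr K : ℚ)).entireLFunction 1 ≠ 0 ∧ ¬ p ∣ NumberField.classNumber K := by
  haveI : Fact (Nat.Prime 11) := ⟨by norm_num⟩
  obtain ⟨K, iF, iN, hK, hdK, hhK⟩ := SylvesterCorner.exists_field_of_odd d h hd0 hd4 hsf hclass
  haveI : NeZero (NumberField.discr K).natAbs := ⟨Int.natAbs_ne_zero.mpr (NumberField.discr_ne_zero K)⟩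
  obtain ⟨hCM, hram, -⟩ := hasCM_cmRamified_of_twist cm11 KrizLiBinders.hasCM_bases.2.1 KrizLiBinders.cmRamified_bases.2.1 he
    W W₁ hiso hW₁
  obtain ⟨f, hf, ψ, ω, εK, hψ, hω, hss, ⟨h1a, h1b⟩, h3, hεK, h4, -⟩ := hblock K hK.1 hdK
  have hHN := hheeg K hK.1 hdK
  obtain ⟨hL, -⟩ := twist_L_one_ne_zero_of_thm120_cm (p := 11) (by norm_num) hKL W hCM hram hr K hK hHN (hGZ _ W K) (hHP W K)
    f ψ ω hψ hω hss h1a h1b h3 εK hεK h4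
  refine ⟨K, iF, iN, hK, by rw [hdK]; exact hd5, hHN, hL, fun hdvd => ?_⟩
  have hh : NumberField.classNumber K < p := by rw [hhK]; exact hhp
  exact absurd (Nat.le_of_dvd (NumberField.classNumber_pos (K := K)) hdvd) (not_le.mpr hh)

/-- ★ **`20449a1 = A(11)^{(13)}`, crux prime `p = 13`** (`13 ≡ 2 (mod 11)` is inert in `ℚ(√−11)`; `K′ = ℚ(√−43)`, `h = 1`): for every globally
minimal `W` `ℚ`-isogenous to a curve `ℚ`-isomorphic to `cm11.quadraticTwist 13` with `r_an(W) ≠ 0`, the CONCLUSION of crux 21381 at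
`(W, 13)`, modulo `hKL`, `hGZ`, `hHP`. [cite: KrizLi2019, Thm. 1.20 (pp. 7–8)] [cite: Cox2013, §2.A Thm. 2.13] -/
theorem cruxConclusion_20449a1 (hKL : thm120_padicLogHeegner_unit_of_bernoulli)
    (hGZ : ∀ (N : ℕ) [NeZero N] (W : WeierstrassCurve ℚ) (K : Type) [Field K] [NumberField K], gross_zagier N W K)
    (hHP : ∀ (W : WeierstrassCurve ℚ) (K : Type) [Field K] [NumberField K], exists_isHeegnerPoint W K)
    (W W₁ : WeierstrassCurve ℚ) [W.IsElliptic] [W.IsGloballyMinimal] [NeZero (W.conductorNorm ℤ)] [W₁.IsElliptic]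
    (hiso : IsIsogenous W W₁) (hW₁ : ∃ C : VariableChange ℚ, C • W₁ = cm11.quadraticTwist ((13 : ℤ) : ℚ))
    (hr : W.analyticRank ≠ 0) :
    ∃ (K : Type) (_ : Field K) (_ : NumberField K),
      IsImaginaryQuadratic K ∧ 4 < (NumberField.discr K).natAbs ∧
      SatisfiesHeegnerHypothesis (W.conductorNorm ℤ) K ∧
      (W.quadraticTwist (NumberField.discr K : ℚ)).entireLFunction 1 ≠ 0 ∧ ¬ 13 ∣ NumberField.classNumber K := by
  haveI : Fact (Nat.Prime 11) := ⟨by norm_num⟩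
  exact cruxConclusion_of_block11 hKL hGZ hHP W W₁ hiso (by norm_num) hW₁ hr (d := -43) (h := 1) (by norm_num) (by norm_num)
    (by rw [show (-43 : ℤ).natAbs = 43 from rfl]; exact (show Nat.Prime 43 by norm_num).squarefree) (by norm_num) (by decide +kernel)
    (by norm_num)
    (fun K _ _ hK2 hdK => exists_krizLiCharacterBlock_20449a1 W W₁ hiso hW₁ K hK2 hdK)
    (fun K _ _ hK2 hdK => satisfiesHeegnerHypothesis_20449a1 W W₁ hiso hW₁ K hK2 hdK)

/-- ★ **`34969a1 = A(11)^{(17)}`, crux prime `p = 17`** (`17 ≡ 6 (mod 11)` is inert in `ℚ(√−11)`; `K′ = ℚ(√−19)`, `h = 1`): for every globally minimal `W`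
`ℚ`-isogenous to a curve `ℚ`-isomorphic to `cm11.quadraticTwist 17` with `r_an(W) ≠ 0`, the CONCLUSION of crux 21381 at `(W, 17)`,
modulo `hKL`, `hGZ`, `hHP`. [cite: KrizLi2019, Thm. 1.20 (pp. 7–8)] [cite: Cox2013, §2.A Thm. 2.13] -/
theorem cruxConclusion_34969a1 (hKL : thm120_padicLogHeegner_unit_of_bernoulli)
    (hGZ : ∀ (N : ℕ) [NeZero N] (W : WeierstrassCurve ℚ) (K : Type) [Field K] [NumberField K], gross_zagier N W K)
    (hHP : ∀ (W : WeierstrassCurve ℚ) (K : Type) [Field K] [NumberField K], exists_isHeegnerPoint W K)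
    (W W₁ : WeierstrassCurve ℚ) [W.IsElliptic] [W.IsGloballyMinimal] [NeZero (W.conductorNorm ℤ)] [W₁.IsElliptic]
    (hiso : IsIsogenous W W₁) (hW₁ : ∃ C : VariableChange ℚ, C • W₁ = cm11.quadraticTwist ((17 : ℤ) : ℚ))
    (hr : W.analyticRank ≠ 0) :
    ∃ (K : Type) (_ : Field K) (_ : NumberField K),
      IsImaginaryQuadratic K ∧ 4 < (NumberField.discr K).natAbs ∧
      SatisfiesHeegnerHypothesis (W.conductorNorm ℤ) K ∧
      (W.quadraticTwist (NumberField.discr K : ℚ)).entireLFunction 1 ≠ 0 ∧ ¬ 17 ∣ NumberField.classNumber K := by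
  haveI : Fact (Nat.Prime 11) := ⟨by norm_num⟩
  exact cruxConclusion_of_block11 hKL hGZ hHP W W₁ hiso (by norm_num) hW₁ hr (d := -19) (h := 1) (by norm_num) (by norm_num)
    (by rw [show (-19 : ℤ).natAbs = 19 from rfl]; exact (show Nat.Prime 19 by norm_num).squarefree) (by norm_num) (by decide +kernel)
    (by norm_num)
    (fun K _ _ hK2 hdK => exists_krizLiCharacterBlock_34969a1 W W₁ hiso hW₁ K hK2 hdK)
    (fun K _ _ hK2 hdK => satisfiesHeegnerHypothesis_34969a1 W W₁ hiso hW₁ K hK2 hdK)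

/-- ★ **`101761a1 = A(11)^{(29)}`, crux prime `p = 29`** (`29 ≡ 7 (mod 11)` is inert; `K′ = ℚ(√−7)`, `h = 1`): for every globally minimal `W`
`ℚ`-isogenous to a curve `ℚ`-isomorphic to `cm11.quadraticTwist 29` with `r_an(W) ≠ 0`, the CONCLUSION of crux 21381 at `(W, 29)`,
modulo `hKL`, `hGZ`, `hHP`. [cite: KrizLi2019, Thm. 1.20 (pp. 7–8)] [cite: Cox2013, §2.A Thm. 2.13] -/
theorem cruxConclusion_101761a1 (hKL : thm120_padicLogHeegner_unit_of_bernoulli)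
    (hGZ : ∀ (N : ℕ) [NeZero N] (W : WeierstrassCurve ℚ) (K : Type) [Field K] [NumberField K], gross_zagier N W K)
    (hHP : ∀ (W : WeierstrassCurve ℚ) (K : Type) [Field K] [NumberField K], exists_isHeegnerPoint W K)
    (W W₁ : WeierstrassCurve ℚ) [W.IsElliptic] [W.IsGloballyMinimal] [NeZero (W.conductorNorm ℤ)] [W₁.IsElliptic]
    (hiso : IsIsogenous W W₁) (hW₁ : ∃ C : VariableChange ℚ, C • W₁ = cm11.quadraticTwist ((29 : ℤ) : ℚ))
    (hr : W.analyticRank ≠ 0) :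
    ∃ (K : Type) (_ : Field K) (_ : NumberField K),
      IsImaginaryQuadratic K ∧ 4 < (NumberField.discr K).natAbs ∧
      SatisfiesHeegnerHypothesis (W.conductorNorm ℤ) K ∧
      (W.quadraticTwist (NumberField.discr K : ℚ)).entireLFunction 1 ≠ 0 ∧ ¬ 29 ∣ NumberField.classNumber K := by
  haveI : Fact (Nat.Prime 11) := ⟨by norm_num⟩
  exact cruxConclusion_of_block11 hKL hGZ hHP W W₁ hiso (by norm_num) hW₁ hr (d := -7) (h := 1) (by norm_num) (by norm_num)
    (by rw [show (-7 : ℤ).natAbs = 7 from rfl]; exact (show Nat.Prime 7 by norm_num).squarefree) (by norm_num) (by decide +kernel)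
    (by norm_num)
    (fun K _ _ hK2 hdK => exists_krizLiCharacterBlock_101761a1 W W₁ hiso hW₁ K hK2 hdK)
    (fun K _ _ hK2 hdK => satisfiesHeegnerHypothesis_101761a1 W W₁ hiso hW₁ K hK2 hdK)

/-- ★ **`450241d1 = A(11)^{(61)}`, crux prime `p = 61`** (`61 ≡ 6 (mod 11)` is inert; `K′ = ℚ(√−19)`, `h = 1`): for every globally minimal `W`
`ℚ`-isogenous to a curve `ℚ`-isomorphic to `cm11.quadraticTwist 61` with `r_an(W) ≠ 0`, the CONCLUSION of crux 21381 at `(W, 61)`,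
modulo `hKL`, `hGZ`, `hHP`. [cite: KrizLi2019, Thm. 1.20 (pp. 7–8)] [cite: Cox2013, §2.A Thm. 2.13] -/
theorem cruxConclusion_450241d1 (hKL : thm120_padicLogHeegner_unit_of_bernoulli)
    (hGZ : ∀ (N : ℕ) [NeZero N] (W : WeierstrassCurve ℚ) (K : Type) [Field K] [NumberField K], gross_zagier N W K)
    (hHP : ∀ (W : WeierstrassCurve ℚ) (K : Type) [Field K] [NumberField K], exists_isHeegnerPoint W K)
    (W W₁ : WeierstrassCurve ℚ) [W.IsElliptic] [W.IsGloballyMinimal] [NeZero (W.conductorNorm ℤ)] [W₁.IsElliptic]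
    (hiso : IsIsogenous W W₁) (hW₁ : ∃ C : VariableChange ℚ, C • W₁ = cm11.quadraticTwist ((61 : ℤ) : ℚ))
    (hr : W.analyticRank ≠ 0) :
    ∃ (K : Type) (_ : Field K) (_ : NumberField K),
      IsImaginaryQuadratic K ∧ 4 < (NumberField.discr K).natAbs ∧
      SatisfiesHeegnerHypothesis (W.conductorNorm ℤ) K ∧
      (W.quadraticTwist (NumberField.discr K : ℚ)).entireLFunction 1 ≠ 0 ∧ ¬ 61 ∣ NumberField.classNumber K := by
  haveI : Fact (Nat.Prime 11) := ⟨by norm_num⟩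
  exact cruxConclusion_of_block11 hKL hGZ hHP W W₁ hiso (by norm_num) hW₁ hr (d := -19) (h := 1) (by norm_num) (by norm_num)
    (by rw [show (-19 : ℤ).natAbs = 19 from rfl]; exact (show Nat.Prime 19 by norm_num).squarefree) (by norm_num) (by decide +kernel)
    (by norm_num)
    (fun K _ _ hK2 hdK => exists_krizLiCharacterBlock_450241d1 W W₁ hiso hW₁ K hK2 hdK)
    (fun K _ _ hK2 hdK => satisfiesHeegnerHypothesis_450241d1 W W₁ hiso hW₁ K hK2 hdK)

/-- ★ **`53361y1 = A(11)^{(21)}`, crux prime `p = 7`** (`e = 21 = 3·7`, `7` is inert in `ℚ(√−11)`; `K′ = ℚ(√−83)`, `h = 3 < 7`): for every globally minimal `W`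
`ℚ`-isogenous to a curve `ℚ`-isomorphic to `cm11.quadraticTwist 21` with `r_an(W) ≠ 0`, the CONCLUSION of crux 21381 at `(W, 7)`,
modulo `hKL`, `hGZ`, `hHP`. [cite: KrizLi2019, Thm. 1.20 (pp. 7–8)] [cite: Cox2013, §2.A Thm. 2.13] -/
theorem cruxConclusion_53361y1 (hKL : thm120_padicLogHeegner_unit_of_bernoulli)
    (hGZ : ∀ (N : ℕ) [NeZero N] (W : WeierstrassCurve ℚ) (K : Type) [Field K] [NumberField K], gross_zagier N W K)
    (hHP : ∀ (W : WeierstrassCurve ℚ) (K : Type) [Field K] [NumberField K], exists_isHeegnerPoint W K)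
    (W W₁ : WeierstrassCurve ℚ) [W.IsElliptic] [W.IsGloballyMinimal] [NeZero (W.conductorNorm ℤ)] [W₁.IsElliptic]
    (hiso : IsIsogenous W W₁) (hW₁ : ∃ C : VariableChange ℚ, C • W₁ = cm11.quadraticTwist ((21 : ℤ) : ℚ))
    (hr : W.analyticRank ≠ 0) :
    ∃ (K : Type) (_ : Field K) (_ : NumberField K),
      IsImaginaryQuadratic K ∧ 4 < (NumberField.discr K).natAbs ∧
      SatisfiesHeegnerHypothesis (W.conductorNorm ℤ) K ∧
      (W.quadraticTwist (NumberField.discr K : ℚ)).entireLFunction 1 ≠ 0 ∧ ¬ 7 ∣ NumberField.classNumber K := by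
  haveI : Fact (Nat.Prime 11) := ⟨by norm_num⟩
  exact cruxConclusion_of_block11 hKL hGZ hHP W W₁ hiso (by norm_num) hW₁ hr (d := -83) (h := 3) (by norm_num) (by norm_num)
    (by rw [show (-83 : ℤ).natAbs = 83 from rfl]; exact (show Nat.Prime 83 by norm_num).squarefree) (by norm_num) (by decide +kernel)
    (by norm_num)
    (fun K _ _ hK2 hdK => exists_krizLiCharacterBlock_53361y1 W W₁ hiso hW₁ K hK2 hdK)
    (fun K _ _ hK2 hdK => satisfiesHeegnerHypothesis_53361y1 W W₁ hiso hW₁ K hK2 hdK)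

/-- ★ **`393129bw1 = A(11)^{(57)}`, crux prime `p = 19`** (`e = 57 = 3·19`, `19 ≡ 8 (mod 11)` is inert; `K′ = ℚ(√−107)`, `h = 3`): for every globally minimal `W`
`ℚ`-isogenous to a curve `ℚ`-isomorphic to `cm11.quadraticTwist 57` with `r_an(W) ≠ 0`, the CONCLUSION of crux 21381 at `(W, 19)`,
modulo `hKL`, `hGZ`, `hHP`. [cite: KrizLi2019, Thm. 1.20 (pp. 7–8)] [cite: Cox2013, §2.A Thm. 2.13] -/
theorem cruxConclusion_393129bw1 (hKL : thm120_padicLogHeegner_unit_of_bernoulli)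
    (hGZ : ∀ (N : ℕ) [NeZero N] (W : WeierstrassCurve ℚ) (K : Type) [Field K] [NumberField K], gross_zagier N W K)
    (hHP : ∀ (W : WeierstrassCurve ℚ) (K : Type) [Field K] [NumberField K], exists_isHeegnerPoint W K)
    (W W₁ : WeierstrassCurve ℚ) [W.IsElliptic] [W.IsGloballyMinimal] [NeZero (W.conductorNorm ℤ)] [W₁.IsElliptic]
    (hiso : IsIsogenous W W₁) (hW₁ : ∃ C : VariableChange ℚ, C • W₁ = cm11.quadraticTwist ((57 : ℤ) : ℚ))
    (hr : W.analyticRank ≠ 0) :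
    ∃ (K : Type) (_ : Field K) (_ : NumberField K),
      IsImaginaryQuadratic K ∧ 4 < (NumberField.discr K).natAbs ∧
      SatisfiesHeegnerHypothesis (W.conductorNorm ℤ) K ∧
      (W.quadraticTwist (NumberField.discr K : ℚ)).entireLFunction 1 ≠ 0 ∧ ¬ 19 ∣ NumberField.classNumber K := by
  haveI : Fact (Nat.Prime 11) := ⟨by norm_num⟩
  exact cruxConclusion_of_block11 hKL hGZ hHP W W₁ hiso (by norm_num) hW₁ hr (d := -107) (h := 3) (by norm_num) (by norm_num)
    (by rw [show (-107 : ℤ).natAbs = 107 from rfl]; exact (show Nat.Prime 107 by norm_num).squarefree) (by norm_num) (by decide +kernel)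
    (by norm_num)
    (fun K _ _ hK2 hdK => exists_krizLiCharacterBlock_393129bw1 W W₁ hiso hW₁ K hK2 hdK)
    (fun K _ _ hK2 hdK => satisfiesHeegnerHypothesis_393129bw1 W W₁ hiso hW₁ K hK2 hdK)

/-- ★ **`203401d1 = A(11)^{(41)}`, crux prime `p = 41`** (`41 ≡ 8 (mod 11)` is inert; `K′ = ℚ(√−39)`, `h = 4`): for every globally minimal `W`
`ℚ`-isogenous to a curve `ℚ`-isomorphic to `cm11.quadraticTwist 41` with `r_an(W) ≠ 0`, the CONCLUSION of crux 21381 at `(W, 41)`,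
modulo `hKL`, `hGZ`, `hHP`. [cite: KrizLi2019, Thm. 1.20 (pp. 7–8)] [cite: Cox2013, §2.A Thm. 2.13] -/
theorem cruxConclusion_203401d1 (hKL : thm120_padicLogHeegner_unit_of_bernoulli)
    (hGZ : ∀ (N : ℕ) [NeZero N] (W : WeierstrassCurve ℚ) (K : Type) [Field K] [NumberField K], gross_zagier N W K)
    (hHP : ∀ (W : WeierstrassCurve ℚ) (K : Type) [Field K] [NumberField K], exists_isHeegnerPoint W K)
    (W W₁ : WeierstrassCurve ℚ) [W.IsElliptic] [W.IsGloballyMinimal] [NeZero (W.conductorNorm ℤ)] [W₁.IsElliptic]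
    (hiso : IsIsogenous W W₁) (hW₁ : ∃ C : VariableChange ℚ, C • W₁ = cm11.quadraticTwist ((41 : ℤ) : ℚ))
    (hr : W.analyticRank ≠ 0) :
    ∃ (K : Type) (_ : Field K) (_ : NumberField K),
      IsImaginaryQuadratic K ∧ 4 < (NumberField.discr K).natAbs ∧
      SatisfiesHeegnerHypothesis (W.conductorNorm ℤ) K ∧
      (W.quadraticTwist (NumberField.discr K : ℚ)).entireLFunction 1 ≠ 0 ∧ ¬ 41 ∣ NumberField.classNumber K := by
  haveI : Fact (Nat.Prime 11) := ⟨by norm_num⟩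
  exact cruxConclusion_of_block11 hKL hGZ hHP W W₁ hiso (by norm_num) hW₁ hr (d := -39) (h := 4) (by norm_num) (by norm_num)
    (by rw [show (-39 : ℤ).natAbs = 39 from rfl]; simpa using KrizLi2019.squarefree_mul_of_prime (p := 3) (q := 13) (by norm_num) (by norm_num) (by norm_num)) (by norm_num) (by decide +kernel)
    (by norm_num)
    (fun K _ _ hK2 hdK => exists_krizLiCharacterBlock_203401d1 W W₁ hiso hW₁ K hK2 hdK)
    (fun K _ _ hK2 hdK => satisfiesHeegnerHypothesis_203401d1 W W₁ hiso hW₁ K hK2 hdK)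

/-- ★ **The crux BODY verbatim at `(W, 13)` on the class of `20449a1 = A(11)^{(13)}`**: `HasCM → r_an = 1 → 5 ≤ 13 → CMInert W 13 →
¬ Good W 13 → supply → ∃ K′` (Heegner for `N(W)`, `4 < |d|`, `L(W^{(d)}, 1) ≠ 0`, `13 ∤ h`), for every globally minimal `W` of the class —
the first five hypotheses and the supply are IDLE, `r_an = 1` is used as `r_an ≠ 0`; modulo `hKL`, `hGZ`, `hHP`.
[cite: KrizLi2019, Thm. 1.20 (pp. 7–8)] [cite: GrossZagier1986, Thm. I.(6.3), V.§1–2] -/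
theorem cruxBody_20449a1 (hKL : thm120_padicLogHeegner_unit_of_bernoulli)
    (hGZ : ∀ (N : ℕ) [NeZero N] (W : WeierstrassCurve ℚ) (K : Type) [Field K] [NumberField K], gross_zagier N W K)
    (hHP : ∀ (W : WeierstrassCurve ℚ) (K : Type) [Field K] [NumberField K], exists_isHeegnerPoint W K)
    (W W₁ : WeierstrassCurve ℚ) [W.IsElliptic] [W.IsGloballyMinimal] [NeZero (W.conductorNorm ℤ)] [W₁.IsElliptic]
    (hiso : IsIsogenous W W₁) (hW₁ : ∃ C : VariableChange ℚ, C • W₁ = cm11.quadraticTwist ((13 : ℤ) : ℚ)) :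
    haveI : Fact (Nat.Prime 13) := ⟨by norm_num⟩
    W.HasCM → W.analyticRank = 1 → 5 ≤ 13 → CMInert W 13 → ¬ Good W 13 →
      (∀ B : ℕ, ∃ (K : Type) (_ : Field K) (_ : NumberField K), IsImaginaryQuadratic K ∧ B < (NumberField.discr K).natAbs ∧
        4 < (NumberField.discr K).natAbs ∧ SatisfiesHeegnerHypothesis (W.conductorNorm ℤ) K ∧ ¬ 13 ∣ NumberField.classNumber K) →
      ∃ (K : Type) (_ : Field K) (_ : NumberField K),
        IsImaginaryQuadratic K ∧ 4 < (NumberField.discr K).natAbs ∧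
        SatisfiesHeegnerHypothesis (W.conductorNorm ℤ) K ∧
        (W.quadraticTwist (NumberField.discr K : ℚ)).entireLFunction 1 ≠ 0 ∧ ¬ 13 ∣ NumberField.classNumber K :=
  fun _ hr _ _ _ _ => cruxConclusion_20449a1 hKL hGZ hHP W W₁ hiso hW₁ (by rw [hr]; exact one_ne_zero)

end Rows11

end Summit.BirchSwinnertonDyer.BirchSwinnertonDyer.Theorems.KrizLiGrossCorner

end
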